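import Mathlib

/-!
# Dyadic levels of a density in `(0,1]`

Crux `Summit.MatrixMultiplication.MatrixMultiplication.Theses.SnSubsetDichotomy.PolynomialSlack`
(item `stmt-MatrixMultiplication-8306`), level-one programme, lead c7 (dyadic hub lemma, level bookkeeping).
The level of `x ∈ (0,1]` is `⌊log₂(1/x)⌋₊`, so that `2^{-(ℓ+1)} < x ≤ 2^{-ℓ}`; densities `≥ 1/n²` have level
`≤ ⌊log₂ n²⌋₊`, and there are at most `3(1 + log n)` levels.
-/

namespace Summit.MatrixMultiplication.MatrixMultiplication.Theorems.PolynomialSlack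

set_option linter.dupNamespace false

/-- **Dyadic level bounds.** For `0 < x ≤ 1` and `ℓ = ⌊log₂(1/x)⌋₊`: `(1/2)^{ℓ+1} < x ≤ (1/2)^ℓ`. [folklore] -/
theorem dyadicLevel_bounds (x : ℝ) (hx0 : 0 < x) (hx1 : x ≤ 1) :
    (1 / 2 : ℝ) ^ (⌊Real.logb 2 (1 / x)⌋₊ + 1) < x ∧ x ≤ (1 / 2 : ℝ) ^ ⌊Real.logb 2 (1 / x)⌋₊ := by
  set y : ℝ := Real.logb 2 (1 / x)
  set k : ℕ := ⌊y⌋₊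
  have hx' : 1 ≤ 1 / x := by
    rw [le_div_iff₀ hx0]
    linarith
  have hy0 : 0 ≤ y := Real.logb_nonneg (by norm_num) hx'
  have hky : (k : ℝ) ≤ y := Nat.floor_le hy0
  have hyk : y < (k : ℝ) + 1 := Nat.lt_floor_add_one y
  have h2y : (2 : ℝ) ^ y = 1 / x := Real.rpow_logb (by norm_num) (by norm_num) (by positivity)
  constructor
  · -- lower bound: `1/x = 2^y < 2^(k+1)`
    have h1 : (2 : ℝ) ^ y < (2 : ℝ) ^ ((k : ℝ) + 1) :=
      Real.rpow_lt_rpow_of_exponent_lt (by norm_num) hyk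
    have h2 : (2 : ℝ) ^ ((k : ℝ) + 1) = (2 : ℝ) ^ (k + 1) := by
      have := Real.rpow_natCast 2 (k + 1)
      push_cast at this
      exact this
    rw [h2y, h2, div_lt_iff₀ hx0] at h1
    have hpos : (0 : ℝ) < 2 ^ (k + 1) := by positivity
    rw [one_div_pow, div_lt_iff₀ hpos]
    linarith [mul_comm x ((2 : ℝ) ^ (k + 1))]
  · -- upper bound: `2^k ≤ 2^y = 1/x`
    have h1 : (2 : ℝ) ^ (k : ℝ) ≤ (2 : ℝ) ^ y :=
      Real.rpow_le_rpow_of_exponent_le (by norm_num) hky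
    rw [h2y, Real.rpow_natCast, le_div_iff₀ hx0] at h1
    have hpos : (0 : ℝ) < 2 ^ k := by positivity
    rw [one_div_pow, le_div_iff₀ hpos]
    linarith [mul_comm x ((2 : ℝ) ^ k)]

/-- **Dyadic levels are antitone.** For `0 < y ≤ x`: `⌊log₂(1/x)⌋₊ ≤ ⌊log₂(1/y)⌋₊`. [folklore] -/
theorem dyadicLevel_mono (x y : ℝ) (hy : 0 < y) (hxy : y ≤ x) :
    ⌊Real.logb 2 (1 / x)⌋₊ ≤ ⌊Real.logb 2 (1 / y)⌋₊ := by
  have hx : 0 < x := lt_of_lt_of_le hy hxy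
  apply Nat.floor_le_floor
  apply Real.logb_le_logb_of_le (by norm_num) (by positivity)
  exact one_div_le_one_div_of_le hy hxy

/-- **Number of dyadic levels above `1/n²`.** For `n ≥ 1`: `⌊log₂((n:ℝ)²)⌋₊ + 1 ≤ 3(1 + log n)`
(as `2/log 2 < 3`). [folklore] -/
theorem dyadicLevel_count (n : ℕ) (hn : 1 ≤ n) :
    ((⌊Real.logb 2 ((n : ℝ) ^ 2)⌋₊ + 1 : ℕ) : ℝ) ≤ 3 * (1 + Real.log n) := by
  have hn' : (1 : ℝ) ≤ n := by exact_mod_cast hn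
  have hlogn : 0 ≤ Real.log n := Real.log_nonneg hn'
  have hlog2 : (0.6931471803 : ℝ) < Real.log 2 := Real.log_two_gt_d9
  have hn2 : (1 : ℝ) ≤ (n : ℝ) ^ 2 := by nlinarith
  have hL0 : 0 ≤ Real.logb 2 ((n : ℝ) ^ 2) := Real.logb_nonneg (by norm_num) hn2
  have hfloor : (⌊Real.logb 2 ((n : ℝ) ^ 2)⌋₊ : ℝ) ≤ Real.logb 2 ((n : ℝ) ^ 2) :=
    Nat.floor_le hL0
  have hL : Real.logb 2 ((n : ℝ) ^ 2) = 2 * Real.log n / Real.log 2 := by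
    rw [Real.logb, Real.log_pow]
    norm_num
  have hL3 : Real.logb 2 ((n : ℝ) ^ 2) ≤ 3 * Real.log n := by
    rw [hL, div_le_iff₀ (by linarith)]
    nlinarith [mul_nonneg hlogn (sub_nonneg.mpr hlog2.le)]
  push_cast
  linarith

end Summit.MatrixMultiplication.MatrixMultiplication.Theorems.PolynomialSlack
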